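import Summits.QuantumFields.BalabanUV.T4Continuum.Support.ShellMeasureLandauHolonomyTermsEnd
import Summits.QuantumFields.BalabanUV.T4Continuum.Support.ShellMeasureWilsonBlock

/-!
# `T4Continuum.ShellMeasureLandauHolonomySkew` — THE UNITARITY TYPE OF THE WEIGHT READ-OUTS, DISCHARGED: in a
# C⋆-normed value algebra (the cell's `M_n(ℂ)` with the operator norm) a SKEW-ADJOINT read-out is `τ`-free for `Re Tr`
# and has a unitary — hence contracting — exponential; the real structure GENERATED by the read-outs is a closed
# additive subgroup on which this holds by construction; the three-sided S22 END with `hℓr` and `IsClosed 𝓡𝒴` no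
# longer binders
(cell `pub-balaban`, sub-cell `t4`, spine estimate NE7c (node U5b); NE7c formalisation swarm, crew seat
`b2b-balaban-t4-ne7c-formalise-leaf-02` gen 4 — file (F) of the OFFER «S22 ROAD, THE WEIGHT SIDE»; imports (D)
`ShellMeasureLandauHolonomyTermsEnd` (p214394) and `ShellMeasureWilsonBlock` (p206256-lineage: the trace datum `Re Tr` on
`M_n(ℂ)` and its skew-adjoint lemmas) ONLY; ONE data `def` (`readOutReal`, an additive subgroup — an object, not a
proposition), 0 `def … : Prop`, 0 sorry)

HONEST FRAMING.  Finite four-torus programme, rung (B)+1 only — NOT infinite volume, NOT a mass gap, NOT the Clay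
problem, NOT summit progress; (B), `BetaPertHyp`, (B^μ) not consumed.  NE7c (`T4IndicatorShell.ShellWeightBound`) is
NOT PRINTED and NOT PROVED; «NE7c ⇐ the named binders»; (M1) realized ≠ NE7c (c3).  Nothing printed is asserted.

WHY.  Files (B)/(C)/(D) carry the displayed binder `hℓr : ∀ p ∈ P_w, ∀ ℓ ∈ ℓw p, ∀ Y ∈ 𝓡𝒴, τ (ℓ Y) = 0 ∧ ‖exp (ℓ Y)‖ ≤ 1`
(«the UNITARITY TYPE of the weight read-outs on real configurations», (176): `U = exp(iη𝓗)` unitary) and the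
closedness of the real subgroup `𝓡𝒴`.  In the cell's value algebra — `M_n(ℂ)` with the OPERATOR norm
(`Matrix.Norms.L2Operator`, the scope of `ShellMeasureWilsonBlock.matrixTrace` and of every realized `SU(2)` file) —
both are THEOREMS once «real» is read as print reads it, «the bond variables are anti-Hermitian»:
* §1 `readOutReal L` — THE REAL STRUCTURE GENERATED BY A SET `L` OF READ-OUTS: the configurations all of whose
  read-outs in `L` are skew-adjoint; an additive subgroup (`skewAdjoint A` is one), CLOSED (`isClosed_readOutReal`:
  preimages of the closed `{a ∣ star a = −a}` under continuous linear maps).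
* §2 `τ_skew_norm_exp_le` — in any complete normed `ℂ`-algebra with a C⋆-norm and continuous star, a skew-adjoint
  element has a UNITARY exponential (Mathlib `NormedSpace.exp_mem_unitary_of_mem_skewAdjoint`), hence
  `‖exp a‖ ≤ 1` (`CStarRing.norm_coe_unitary`); with a trace datum vanishing on skew-adjoint elements this is the
  letter condition; `hℓr_of_skew` / `hℓr_readOutReal` — the binder `hℓr` of files (B)/(C)/(D) from «read-outs of real
  configurations are skew-adjoint», resp. BY CONSTRUCTION for `𝓡𝒴 := readOutReal L` with `L ⊇` the weight read-outs.
* §3 the MATRIX INSTANCE: `Re Tr` vanishes on `𝔲(n)` (`ShellMeasureWilsonBlock.re_trace_eq_zero_of_mem_skewAdjoint`),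
  so for `A = M_n(ℂ)`, `T = matrixTrace`: `hℓr_matrix`, `hℓr_matrix_readOutReal` — NO hypothesis left beyond
  skew-adjointness of the read-outs.
* §4 `slotAC_realized_su2_landauChart_threeSided_skew` — file (D)'s three-sided END at `A := M_n(ℂ)`,
  `Ttr := matrixTrace`, `𝓡𝒴 := readOutReal L`: the binders `Ttr`/`hN`, `h𝓡𝒴 : IsClosed 𝓡𝒴` and `hℓr` are GONE
  (theorems); in their place ONE inclusion `hL : ∀ p ∈ P_w, ∀ ℓ ∈ ℓw p, ℓ ∈ L`.  The preservation binders
  (`h𝒢r … hΦr`) are now stated relative to THIS canonical real structure: «the scheme maps preserve the configurations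
  whose `L`-read-outs are anti-Hermitian» — (115)/(176) TYPE, displayed, not instantiated.
NOT an instance of Bałaban's minimiser; NE7c NOT PROVED; spine PROVED 0/9.  HONEST DEPENDENCY (cell): continuum YM on
T⁴ ⇐ BetaPertH ∧ nine spine estimates (0/9 proved); BetaPertH ⇐ (D1) ∧ (D4) ∧ CAP+tail; G-an2-4 gates asym, D1 and
NE2/3/4.
-/

noncomputable section

open Set Metric NormedSpace MeasureTheory Function

namespace Summit.QuantumFields.BalabanUV.T4Continuum.ShellMeasureLandauHolonomySkew

open scoped ENNReal
open Literature.MathematicalPhysics.QuantumFieldTheory.Balaban1983to89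
open B11Prop6Scheme (Prop4Hyp)
open GaugeField (GaugeInvariant)
open T4ShellMeasure (SlotAntiConcentration)
open T4CubePoincare (cube)
open T4CubeChartGnomonic (SU2)
open T4CubeChartExp (expWindowDensity expFibreChart)
open T4ShellMeasureDet (blockLaw)
open T4TreeGaugeFixing (NoClosedLoop fixTo)
open ShellMeasureWilsonTrace (TraceData)
open ShellMeasureWilsonBlock (matrixTrace matrixTrace_N_pos re_trace_eq_zero_of_mem_skewAdjoint
  norm_exp_real_smul_eq_one)
open ShellMeasureLevelAssembly (classifier weight)
open ShellMeasureLandauHolonomy (solAt landauExp)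
open ShellMeasureLandauHolonomyChart (holOf cplx)
open ShellMeasureLandauHolonomyTermsEnd (slotAC_realized_su2_landauChart_threeSided)

variable {𝒴 : Type*} [NormedAddCommGroup 𝒴] [NormedSpace ℂ 𝒴]
variable {A : Type*} [NormedRing A] [NormedAlgebra ℂ A]

/-! ## §1 The real structure generated by a set of read-outs -/

section Generated

variable [StarAddMonoid A]

/-- **THE REAL STRUCTURE GENERATED BY THE READ-OUTS `L`**: the configurations `Y` all of whose read-outs `ℓ Y`, `ℓ ∈ L`,
are SKEW-ADJOINT (anti-Hermitian bond variables — (115)/(176) TYPE).  An additive subgroup; an object, not a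
proposition. [folklore] -/
def readOutReal (L : Set (𝒴 →L[ℂ] A)) : AddSubgroup 𝒴 where
  carrier := {Y | ∀ ℓ ∈ L, ℓ Y ∈ skewAdjoint A}
  add_mem' {a b} ha hb := fun ℓ hℓ => by
    rw [map_add]
    exact (skewAdjoint A).add_mem (ha ℓ hℓ) (hb ℓ hℓ)
  zero_mem' := fun ℓ _ => by
    rw [map_zero]
    exact (skewAdjoint A).zero_mem
  neg_mem' {a} ha := fun ℓ hℓ => by
    rw [map_neg]
    exact (skewAdjoint A).neg_mem (ha ℓ hℓ)

/-- membership unfolded. [folklore] -/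
theorem mem_readOutReal {L : Set (𝒴 →L[ℂ] A)} {Y : 𝒴} : Y ∈ readOutReal L ↔ ∀ ℓ ∈ L, ℓ Y ∈ skewAdjoint A :=
  Iff.rfl

/-- the generated real structure IS CLOSED (continuous star; preimages of the closed `{a ∣ star a = −a}` under
continuous linear maps). [folklore] -/
theorem isClosed_readOutReal [ContinuousStar A] (L : Set (𝒴 →L[ℂ] A)) :
    IsClosed (readOutReal L : Set 𝒴) := by
  have h : (readOutReal L : Set 𝒴) = ⋂ ℓ ∈ L, {Y : 𝒴 | star (ℓ Y) = -(ℓ Y)} := by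
    ext Y
    simp only [SetLike.mem_coe, mem_readOutReal, skewAdjoint.mem_iff, mem_iInter, mem_setOf_eq]
  rw [h]
  exact isClosed_biInter fun ℓ _ =>
    isClosed_eq (continuous_star.comp ℓ.continuous) (continuous_neg.comp ℓ.continuous)

end Generated

/-! ## §2 Skew-adjoint read-outs are admissible letters (C⋆-norm) -/

section CStar

variable [CompleteSpace A] [StarRing A] [ContinuousStar A] [CStarRing A] [Nontrivial A]

/-- **A SKEW-ADJOINT ELEMENT IS `τ`-FREE WITH A CONTRACTING EXPONENTIAL** — for a trace datum vanishing on skew-adjoint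
elements (as `Re Tr` does) and a C⋆-norm: `exp a` is UNITARY (Mathlib `NormedSpace.exp_mem_unitary_of_mem_skewAdjoint`),
so `‖exp a‖ = 1 ≤ 1` (`CStarRing.norm_coe_unitary`). [folklore] -/
theorem τ_skew_norm_exp_le (T : TraceData A) (hτ : ∀ a ∈ skewAdjoint A, T.τ a = 0) {a : A}
    (ha : a ∈ skewAdjoint A) : T.τ a = 0 ∧ ‖exp a‖ ≤ 1 := by
  letI : NormedAlgebra ℚ A := NormedAlgebra.restrictScalars ℚ ℂ A
  exact ⟨hτ a ha, (CStarRing.norm_coe_unitary ⟨_, exp_mem_unitary_of_mem_skewAdjoint ha⟩).le⟩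

/-- **THE BINDER `hℓr` OF FILES (B)/(C)/(D) FROM SKEW-ADJOINTNESS**: if every weight read-out of every real
configuration is skew-adjoint, the unitarity type holds. [folklore] -/
theorem hℓr_of_skew (T : TraceData A) (hτ : ∀ a ∈ skewAdjoint A, T.τ a = 0) {𝔭 : Type*} (Pw : Finset 𝔭)
    (ℓw : 𝔭 → List (𝒴 →L[ℂ] A)) (𝓡𝒴 : AddSubgroup 𝒴)
    (hskew : ∀ p ∈ Pw, ∀ ℓ ∈ ℓw p, ∀ Y ∈ 𝓡𝒴, ℓ Y ∈ skewAdjoint A) :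
    ∀ p ∈ Pw, ∀ ℓ ∈ ℓw p, ∀ Y ∈ 𝓡𝒴, T.τ (ℓ Y) = 0 ∧ ‖exp (ℓ Y)‖ ≤ 1 :=
  fun p hp ℓ hℓ Y hY => τ_skew_norm_exp_le T hτ (hskew p hp ℓ hℓ Y hY)

/-- **… BY CONSTRUCTION for the generated real structure**: with `𝓡𝒴 := readOutReal L` and the weight read-outs in `L`,
the unitarity type holds with no further hypothesis. [folklore] -/
theorem hℓr_readOutReal (T : TraceData A) (hτ : ∀ a ∈ skewAdjoint A, T.τ a = 0) {𝔭 : Type*} (Pw : Finset 𝔭)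
    (ℓw : 𝔭 → List (𝒴 →L[ℂ] A)) (L : Set (𝒴 →L[ℂ] A)) (hL : ∀ p ∈ Pw, ∀ ℓ ∈ ℓw p, ℓ ∈ L) :
    ∀ p ∈ Pw, ∀ ℓ ∈ ℓw p, ∀ Y ∈ readOutReal L, T.τ (ℓ Y) = 0 ∧ ‖exp (ℓ Y)‖ ≤ 1 :=
  hℓr_of_skew T hτ Pw ℓw (readOutReal L) fun p hp ℓ hℓ _ hY => hY ℓ (hL p hp ℓ hℓ)

end CStar

/-! ## §3 The matrix instance: `A = M_n(ℂ)` with the operator norm, `T = Re Tr` -/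

section MatrixInstance

open scoped Matrix.Norms.L2Operator

variable {n : Type*} [Fintype n] [DecidableEq n] [Nonempty n]

/-- **THE UNITARITY TYPE IN `M_n(ℂ)` (operator norm), NO HYPOTHESIS BEYOND SKEW-ADJOINTNESS**: `Re Tr` vanishes on `𝔲(n)`
(`ShellMeasureWilsonBlock.re_trace_eq_zero_of_mem_skewAdjoint`) and `exp` of an anti-Hermitian matrix is unitary
(`ShellMeasureWilsonBlock.norm_exp_real_smul_eq_one`). [folklore] -/
theorem τ_skew_norm_exp_le_matrix {Y : Matrix n n ℂ} (hY : Y ∈ skewAdjoint (Matrix n n ℂ)) :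
    (matrixTrace (n := n)).τ Y = 0 ∧ ‖exp Y‖ ≤ 1 := by
  refine ⟨re_trace_eq_zero_of_mem_skewAdjoint hY, ?_⟩
  have h := norm_exp_real_smul_eq_one hY 1
  rw [Complex.ofReal_one, one_smul] at h
  exact h.le

/-- **`hℓr` FOR MATRIX-VALUED READ-OUTS** from skew-adjointness on the real configurations. [folklore] -/
theorem hℓr_matrix {𝔭 : Type*} (Pw : Finset 𝔭) (ℓw : 𝔭 → List (𝒴 →L[ℂ] Matrix n n ℂ)) (𝓡𝒴 : AddSubgroup 𝒴)
    (hskew : ∀ p ∈ Pw, ∀ ℓ ∈ ℓw p, ∀ Y ∈ 𝓡𝒴, ℓ Y ∈ skewAdjoint (Matrix n n ℂ)) :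
    ∀ p ∈ Pw, ∀ ℓ ∈ ℓw p, ∀ Y ∈ 𝓡𝒴, (matrixTrace (n := n)).τ (ℓ Y) = 0 ∧ ‖exp (ℓ Y)‖ ≤ 1 :=
  fun p hp ℓ hℓ Y hY => τ_skew_norm_exp_le_matrix (hskew p hp ℓ hℓ Y hY)

/-- **`hℓr` FOR MATRIX-VALUED READ-OUTS, BY CONSTRUCTION** on `readOutReal L`, `L ⊇` the weight read-outs. [folklore] -/
theorem hℓr_matrix_readOutReal {𝔭 : Type*} (Pw : Finset 𝔭) (ℓw : 𝔭 → List (𝒴 →L[ℂ] Matrix n n ℂ))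
    (L : Set (𝒴 →L[ℂ] Matrix n n ℂ)) (hL : ∀ p ∈ Pw, ∀ ℓ ∈ ℓw p, ℓ ∈ L) :
    ∀ p ∈ Pw, ∀ ℓ ∈ ℓw p, ∀ Y ∈ readOutReal L, (matrixTrace (n := n)).τ (ℓ Y) = 0 ∧ ‖exp (ℓ Y)‖ ≤ 1 :=
  hℓr_matrix Pw ℓw (readOutReal L) fun p hp ℓ hℓ _ hY => hY ℓ (hL p hp ℓ hℓ)

end MatrixInstance

/-! ## §4 The three-sided S22 END, matrix-valued, with the real structure generated by the read-outs -/

section EndSkew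

open scoped Matrix.Norms.L2Operator

variable {P : Params} {j : ℕ} [DecidableEq (PBond P j)]
variable {n : Type*} [Fintype n] [DecidableEq n] [Nonempty n]
variable {𝒴' 𝒳 𝒵 ℬ : Type*} [CompleteSpace 𝒴]
  [NormedAddCommGroup 𝒴'] [NormedSpace ℂ 𝒴'] [NormedAddCommGroup 𝒳] [NormedSpace ℂ 𝒳] [CompleteSpace 𝒳]
  [NormedAddCommGroup 𝒵] [NormedSpace ℂ 𝒵] [NormedAddCommGroup ℬ] [NormedSpace ℂ ℬ]

/-- **REALIZED (M1) PER SLOT (`G = SU(2)`), ALL THREE LEVEL FUNCTIONALS DEFINED, MATRIX-VALUED READ-OUTS, THE REAL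
STRUCTURE GENERATED BY A READ-OUT SET `L`** — file (D)'s `slotAC_realized_su2_landauChart_threeSided` at
`A := M_n(ℂ)` (operator norm), `Ttr := matrixTrace`, `𝓡𝒴 := readOutReal L`: the binders `Ttr`, `hN`, `h𝓡𝒴 : IsClosed 𝓡𝒴`
and the unitarity type `hℓr` are THEOREMS (§1–§3) and disappear; in their place ONE inclusion `hL` (the weight read-outs
lie in `L`).  The preservation binders now READ: `𝒢 V`, `W𝒱 V`, `ιs V`, `Hop V`, `Cf V`, `H₁ V` preserve the configurations
with anti-Hermitian `L`-read-outs (resp. their images `𝓡𝒵`, `𝓡𝒴′`, `𝓡𝒳`, `𝓡ℬ`), and `Φ V` maps real chart points there.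
CONCLUSION: E2′'s, literally (as in (D)).  A junction; CONDITIONAL on every binder; nothing PRINTED is asserted; NOT
Bałaban's minimiser. [folklore] -/
theorem slotAC_realized_su2_landauChart_threeSided_skew {T : Finset (PBond P j)} (hT : NoClosedLoop T)
    (U₀ : GaugeField P j SU2) (Λ : Finset (PBond P j)) {m₀ : ℕ} (e : ↥Λ × Fin 3 ≃ Fin m₀)
    {S : ℝ} (hS : 0 < S) (hSπ : 3 * S ^ 2 < Real.pi ^ 2) (c : GaugeField P j SU2 → GaugeField P j SU2)
    {R : GaugeField P j SU2 → (↥Λ → SU2) → ℝ≥0∞} (hR : ∀ V, Measurable (R V))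
    {F : GaugeField P j SU2 → ℝ≥0∞} (hF : Measurable F) (hFi : GaugeInvariant F)
    (hFw : ∀ V y, F (fixTo T U₀ (updateFinset V Λ y)) =
      ENNReal.ofReal (expWindowDensity Λ (c V) S (updateFinset (c V) Λ y)) * R V y)
    (hfin : ∀ V, ((blockLaw Λ).withDensity fun y => F (fixTo T U₀ (updateFinset V Λ y))) univ ≠ ∞)
    {u : GaugeField P j SU2 → ℝ} (hu : Measurable u) (hui : GaugeInvariant u)
    -- plaquette index sets, window, co-test
    {ι κ : Type*} {Pu : Finset ι} (hPu : Pu.Nonempty) (Pw : Finset κ)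
    (W : GaugeField P j SU2 → Set (Fin m₀ → ℝ)) (Jco : GaugeField P j SU2 → (Fin m₀ → ℝ) → ℝ≥0∞)
    {θ δ ρ β : ℝ}
    -- THE SCHEME DATA per exterior section
    (𝒢 : GaugeField P j SU2 → (𝒵 →L[ℂ] 𝒴)) (W𝒱 : GaugeField P j SU2 → 𝒴 → 𝒵) {B₀ C₄ a₃ b ε₄ : ℝ}
    (h𝒢 : ∀ V f, ‖𝒢 V f‖ ≤ B₀ * ‖f‖) (hW : ∀ V, Prop4Hyp (W𝒱 V) C₄ a₃) (hB₀ : 0 < B₀) (hC₄ : 0 ≤ C₄)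
    (hε₄ : 0 ≤ ε₄) (hdom : 2 * (ε₄ + B₀ * b) ≤ a₃) (hself : B₀ * C₄ * (ε₄ + B₀ * b) ^ 2 ≤ ε₄)
    (hcontr : 4 * B₀ * C₄ * (ε₄ + B₀ * b) < 1)
    (H₁ : GaugeField P j SU2 → (ℬ →L[ℂ] 𝒴)) (hH₁ : ∀ V B, ‖H₁ V B‖ ≤ B₀ * ‖B‖)
    (Φ : GaugeField P j SU2 → (Fin m₀ → ℂ) → ℬ) {rΦ : ℝ} (hΦd : ∀ V, DifferentiableOn ℂ (Φ V) (ball 0 rΦ))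
    (hΦ0 : ∀ V, Φ V 0 = 0) (hΦ : ∀ V, ∀ z ∈ ball (0 : Fin m₀ → ℂ) rΦ, ‖Φ V z‖ < b) (hSr : S < rΦ)
    (Cf : GaugeField P j SU2 → 𝒴' → 𝒳) {C₂ RC : ℝ} (hC₂ : 0 ≤ C₂)
    (hCq : ∀ V, ∀ Z : 𝒴', ‖Z‖ < RC → ‖Cf V Z‖ ≤ C₂ * ‖Z‖ ^ 2) (hCd : ∀ V, DifferentiableOn ℂ (Cf V) (ball 0 RC))
    (ιs : GaugeField P j SU2 → (𝒴 →L[ℂ] 𝒴')) (hι : ∀ V Y, ‖ιs V Y‖ ≤ ‖Y‖)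
    (Hop : GaugeField P j SU2 → (𝒳 →L[ℂ] 𝒴)) (hH : ∀ V X, ‖Hop V X‖ ≤ B₀ * ‖X‖)
    (hq : 9 * C₂ * B₀ * (ε₄ + B₀ * b) < 1) (hRC : 3 * (ε₄ + B₀ * b) ≤ RC)
    -- the classifier read-outs, the WEIGHT read-outs, the per-term functionals — values in `M_n(ℂ)`
    (ℓs : ι → List (𝒴 →L[ℂ] Matrix n n ℂ)) {κr : ℝ} (hκ : 0 ≤ κr)
    (hℓ : ∀ p ∈ Pu, ∀ ℓ ∈ ℓs p, ∀ Y, ‖ℓ Y‖ ≤ κr * ‖Y‖) {m : ℕ} (hlen : ∀ p ∈ Pu, (ℓs p).length ≤ m)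
    (ℓw : κ → List (𝒴 →L[ℂ] Matrix n n ℂ)) {κw : ℝ} (hκw : 0 ≤ κw)
    (hℓw : ∀ p ∈ Pw, ∀ ℓ ∈ ℓw p, ∀ Y, ‖ℓ Y‖ ≤ κw * ‖Y‖) {mw : ℕ} (hlenw : ∀ p ∈ Pw, (ℓw p).length ≤ mw)
    {𝔱 : Type*} (I : Finset 𝔱) (Ef : GaugeField P j SU2 → 𝔱 → 𝒴 → ℂ) {rE : ℝ} {eb : 𝔱 → ℝ} {Hbar : ℝ}
    (hEd : ∀ V, ∀ i ∈ I, DifferentiableOn ℂ (Ef V i) (ball 0 rE))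
    (hEb : ∀ V, ∀ i ∈ I, ∀ Z ∈ ball (0 : 𝒴) rE, ‖Ef V i Z‖ ≤ eb i) (hsum : ∑ i ∈ I, 2 * eb i ≤ Hbar)
    (hcoupE : (ε₄ + B₀ * b) + B₀ * (4 * C₂ * (ε₄ + B₀ * b) ^ 2) ≤ rE)
    -- THE REAL STRUCTURE GENERATED BY A READ-OUT SET `L` containing the weight read-outs; its images; preservation
    (L : Set (𝒴 →L[ℂ] Matrix n n ℂ)) (hL : ∀ p ∈ Pw, ∀ ℓ ∈ ℓw p, ℓ ∈ L)
    (𝓡𝒵 : AddSubgroup 𝒵) (𝓡𝒴' : AddSubgroup 𝒴') (𝓡𝒳 : AddSubgroup 𝒳) (h𝓡𝒳 : IsClosed (𝓡𝒳 : Set 𝒳))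
    (𝓡ℬ : AddSubgroup ℬ)
    (h𝒢r : ∀ V, ∀ f ∈ 𝓡𝒵, 𝒢 V f ∈ readOutReal L) (hWr : ∀ V, ∀ Y ∈ readOutReal L, W𝒱 V Y ∈ 𝓡𝒵)
    (hιr : ∀ V, ∀ Y ∈ readOutReal L, ιs V Y ∈ 𝓡𝒴') (hHr : ∀ V, ∀ X ∈ 𝓡𝒳, Hop V X ∈ readOutReal L)
    (hCr : ∀ V, ∀ Z ∈ 𝓡𝒴', Cf V Z ∈ 𝓡𝒳) (hH₁r : ∀ V, ∀ B ∈ 𝓡ℬ, H₁ V B ∈ readOutReal L)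
    (hΦr : ∀ V, ∀ y : Fin m₀ → ℝ, ‖y‖ ≤ S → Φ V (cplx y) ∈ 𝓡ℬ)
    -- DICTIONARY (on the chart cube only), with the DEFINED hol, G, 𝓔
    (hRdict : ∀ V, ∀ x ∈ cube m₀ S,
      R V (expFibreChart Λ (c V) e x) = Jco V x * weight (matrixTrace (n := n)) β Pw
        (fun p => holOf (ℓw p) (fun y => landauExp (Cf V) (ιs V) (Hop V) (4 * C₂ * (ε₄ + B₀ * b) ^ 2)
          (solAt (𝒢 V) 0 (W𝒱 V) ε₄ (0 : 𝒵) (H₁ V (Φ V (cplx y))) + H₁ V (Φ V (cplx y)))))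
        (fun y => (∑ i ∈ I, Ef V i (landauExp (Cf V) (ιs V) (Hop V) (4 * C₂ * (ε₄ + B₀ * b) ^ 2)
          (solAt (𝒢 V) 0 (W𝒱 V) ε₄ (0 : 𝒵) (H₁ V (Φ V (cplx y))) + H₁ V (Φ V (cplx y))))).re) x)
    (hudict : ∀ V, ∀ x ∈ cube m₀ S,
      u (fixTo T U₀ (updateFinset V Λ (expFibreChart Λ (c V) e x))) =
        classifier hPu (fun p => holOf (ℓs p) (fun y => landauExp (Cf V) (ιs V) (Hop V)
          (4 * C₂ * (ε₄ + B₀ * b) ^ 2)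
          (solAt (𝒢 V) 0 (W𝒱 V) ε₄ (0 : 𝒵) (H₁ V (Φ V (cplx y))) + H₁ V (Φ V (cplx y))))) x)
    -- co-tests, window
    (hJW : ∀ V x, Jco V x ≠ 0 → x ∈ W V)
    (hJ : ∀ V x, ∀ a : ℝ, 0 ≤ a → Jco V x ≤ Jco V (Real.exp (-a) • x))
    (hWS : ∀ V, W V ⊆ closedBall (0 : Fin m₀ → ℝ) S)
    -- numbers + the weight-side smallness + SM-L2 (SM)
    (hθ : 0 < θ) (hδ0 : 0 ≤ δ) (hδ1 : δ < 1) (hρ0 : 0 ≤ ρ) (hρ : ρ ≤ (1 - δ) / 2) (hβ : 0 ≤ β)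
    (hsw1 : mw * (κw * ((ε₄ + B₀ * b) + B₀ * (4 * C₂ * (ε₄ + B₀ * b) ^ 2))) ≤ 1)
    (hSM : 36 * (Real.exp (m * (κr * ((ε₄ + B₀ * b) + B₀ * (4 * C₂ * (ε₄ + B₀ * b) ^ 2)))) - 1) * 1 ^ 2 /
      (rΦ / S - 1) ^ 2 ≤ δ * θ) :
    SlotAntiConcentration ((fieldMeasure P j SU2).withDensity F) u θ ρ
      (2 * ((m₀ : ℝ) + (β * ∑ _p ∈ Pw,
        (mw * (3 * (κw * ((ε₄ + B₀ * b) + B₀ * (4 * C₂ * (ε₄ + B₀ * b) ^ 2))) / (rΦ / S - 1))) *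
          (0 + 4 * (mw * (κw * ((ε₄ + B₀ * b) + B₀ * (4 * C₂ * (ε₄ + B₀ * b) ^ 2))))) +
        3 * Hbar / (rΦ / S - 1))) / (1 - δ)) :=
  slotAC_realized_su2_landauChart_threeSided hT U₀ Λ e hS hSπ c hR hF hFi hFw hfin hu hui (matrixTrace (n := n))
    matrixTrace_N_pos hPu Pw W Jco 𝒢 W𝒱 h𝒢 hW hB₀ hC₄ hε₄ hdom hself hcontr H₁ hH₁ Φ hΦd hΦ0 hΦ hSr Cf hC₂ hCq hCd
    ιs hι Hop hH hq hRC ℓs hκ hℓ hlen ℓw hκw hℓw hlenw I Ef hEd hEb hsum hcoupE (readOutReal L)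
    (isClosed_readOutReal L) 𝓡𝒵 𝓡𝒴' 𝓡𝒳 h𝓡𝒳 𝓡ℬ h𝒢r hWr hιr hHr hCr hH₁r hΦr
    (hℓr_matrix_readOutReal Pw ℓw L hL) hRdict hudict hJW hJ hWS hθ hδ0 hδ1 hρ0 hρ hβ hsw1 hSM

end EndSkew

end Summit.QuantumFields.BalabanUV.T4Continuum.ShellMeasureLandauHolonomySkew
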